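import Summits.AtomisticToContinuum.Crystallization.Theorems.PeriodCoherenceLadderSparseTransfer
import Summits.AtomisticToContinuum.Crystallization.Theorems.ChargedEnergyGap.Negative.Unconditional
import Summits.AtomisticToContinuum.Crystallization.Theorems.ChessboardParticlePlanesLjLaminarWindowsMinDistance

/-!
# `PeriodCoherenceLadder.MesoscopicFromCosts` — the glue of the split of the residual crux

Route `PeriodCoherenceLadder`, residual crux `MesoscopicCoarsePeriods` (stmt-AtomisticToContinuum-27482),
split (gen 1) into `FrustratedSitesCost` (stmt-AtomisticToContinuum-28514, the one new Lennard-Jones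
inequality) and `ExposedSitesCostLargeR` (stmt-AtomisticToContinuum-28515, = `SurfaceTensionNoFoam.ExposedSitesCost`
for radii `R ≥ 1`), with glue item `MesoscopicFromCosts` (stmt-AtomisticToContinuum-28516):

`FrustratedSitesCost → ExposedSitesCostLargeR → MesoscopicCoarsePeriods`.

This file PROVES the glue item.  The work is the landed chain
`…CleanRegions` → `…CleanWindows` → `…SparseTransferWindows` → `…SparseTransfer`
(`noBadBalls_of_costs`); here we only (i) redo the short wrapper `sparse_of_costs` for the `R ≥ 1` form of the
exposed-sites inequality and (ii) discharge the two facts that the landed `mesoscopicCoarsePeriods_of_costs`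
kept as hypotheses, by the landed theorems
`ChargedEnergyGapNegative.crysEnergyLimit` (`E(N)/N → e*`) and
`LjLaminarWindowsSketch.lennardJones_groundState_dist_ge_seven_tenths` (uniform separation `7/10`).
-/

noncomputable section

open Literature.MathematicalPhysics.StatisticalMechanics

namespace Summit.AtomisticToContinuum.Crystallization.Theorems

namespace PeriodCoherenceLadderMesoscopicFromCosts

/-- The wrapper `sparse_of_costs` of `…SparseTransfer`, for the exposed-sites inequality at radii `R ≥ 1`
(which is all it uses: it is applied at `R' = max (4b + 2r₀ + 4) (r₀ + 1) ≥ 1`). -/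
theorem sparse_of_costs_largeR :
    (∀ r₀ : ℝ, 0 < r₀ → ∃ δ b κ C : ℝ, 0 < δ ∧ δ ≤ 7 / 10 ∧ 0 < κ ∧ ∀ (N : ℕ) (y : Fin N → EuclideanSpace ℝ (Fin 3)), Literature.MathematicalPhysics.StatisticalMechanics.IsGroundState Literature.MathematicalPhysics.StatisticalMechanics.lennardJones y → κ * (Nat.card {i : Fin N // ¬ ∃ t : EuclideanSpace ℝ (Fin 3), δ ≤ ‖t‖ ∧ ‖t‖ ≤ b ∧ ∀ j : Fin N, dist (y j) (y i) ≤ 4 * b + 2 * r₀ + 3 → (∃ k : Fin N, dist (y j + t) (y k) ≤ δ / 4) ∧ (∃ k : Fin N, dist (y j - t) (y k) ≤ δ / 4)} : ℝ) ≤ (Literature.MathematicalPhysics.StatisticalMechanics.groundStateEnergy Literature.MathematicalPhysics.StatisticalMechanics.lennardJones 3 N - (N : ℝ) * (⨅ Q : Literature.MathematicalPhysics.StatisticalMechanics.PeriodicConfiguration 3, Q.energyPerParticle Literature.MathematicalPhysics.StatisticalMechanics.lennardJones)) + C * (Nat.card {i : Fin N // ∃ p : EuclideanSpace ℝ (Fin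 3), dist p (y i) ≤ 4 * b + 2 * r₀ + 4 ∧ ∀ j : Fin N, r₀ ≤ dist p (y j)} : ℝ)) → (∃ r₀ : ℝ, 0 < r₀ ∧ ∀ R : ℝ, 1 ≤ R → ∃ c : ℝ, 0 < c ∧ ∀ (N : ℕ) (x : Fin N → EuclideanSpace ℝ (Fin 3)), Literature.MathematicalPhysics.StatisticalMechanics.IsGroundState Literature.MathematicalPhysics.StatisticalMechanics.lennardJones x → c * (Nat.card {i : Fin N // ∃ p : EuclideanSpace ℝ (Fin 3), dist p (x i) ≤ R ∧ ∀ j : Fin N, r₀ ≤ dist p (x j)} : ℝ) ≤ Literature.MathematicalPhysics.StatisticalMechanics.groundStateEnergy Literature.MathematicalPhysics.StatisticalMechanics.lennardJones 3 N - (N : ℝ) * (⨅ Q : Literature.MathematicalPhysics.StatisticalMechanics.PeriodicConfiguration 3, Q.energyPerParticle Literature.MathematicalPhysics.StatisticalMechanics.lennardJones)) → (Filter.Tendsto (fun N : ℕ => Literature.MathematicalPhysics.StatisticalMechanics.groundStateEnergy Literature.MathematicalPhysics.StatisticalMechanics.lennardJones 3 N / N) Filter.atTop (nhds (⨅ Q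 : Literature.MathematicalPhysics.StatisticalMechanics.PeriodicConfiguration 3, Q.energyPerParticle Literature.MathematicalPhysics.StatisticalMechanics.lennardJones))) → (∀ (N : ℕ) (y : Fin N → EuclideanSpace ℝ (Fin 3)), Literature.MathematicalPhysics.StatisticalMechanics.IsGroundState Literature.MathematicalPhysics.StatisticalMechanics.lennardJones y → ∀ i j : Fin N, i ≠ j → (7 : ℝ) / 10 ≤ dist (y i) (y j)) → ∀ x : (N : ℕ) → (Fin N → EuclideanSpace ℝ (Fin 3)), (∀ N, Literature.MathematicalPhysics.StatisticalMechanics.IsGroundState Literature.MathematicalPhysics.StatisticalMechanics.lennardJones (x N)) → (∃ X : Set (EuclideanSpace ℝ (Fin 3)), ((∃ δ : ℝ, 0 < δ ∧ ∀ p ∈ X, ∀ q ∈ X, p ≠ q → δ ≤ dist p q) ∧ (∃ r : ℝ, ∀ c : EuclideanSpace ℝ (Fin 3), ∃ p ∈ X, dist p c ≤ r)) ∧ (∀ R ε : ℝ, 0 < ε → ∃ᶠ N in Filter.atTop, ∃ t : EuclideanSpace ℝ (Fin 3), (∀ p ∈ X, ‖p‖ ≤ R → ∃ i : Fin N, dist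 (x N i + t) p ≤ ε) ∧ (∀ i : Fin N, ‖x N i + t‖ ≤ R → ∃ p ∈ X, dist (x N i + t) p ≤ ε))) → ∃ δ r b : ℝ, 0 < δ ∧ ∃ X : Set (EuclideanSpace ℝ (Fin 3)), (∀ p ∈ X, ∀ q ∈ X, p ≠ q → δ ≤ dist p q) ∧ (∀ c : EuclideanSpace ℝ (Fin 3), ∃ p ∈ X, dist p c ≤ r) ∧ (∀ R ε : ℝ, 0 < ε → ∃ᶠ N in Filter.atTop, ∃ t : EuclideanSpace ℝ (Fin 3), (∀ p ∈ X, ‖p‖ ≤ R → ∃ i : Fin N, dist (x N i + t) p ≤ ε) ∧ (∀ i : Fin N, ‖x N i + t‖ ≤ R → ∃ p ∈ X, dist (x N i + t) p ≤ ε)) ∧ ∀ ε : ℝ, 0 < ε → ∃ L₀ : ℝ, ∀ L : ℝ, L₀ ≤ L → ∀ F : Finset (EuclideanSpace ℝ (Fin 3)), (∀ c ∈ F, ‖c‖ ≤ L) → (∀ c ∈ F, ¬ ∃ t : EuclideanSpace ℝ (Fin 3), δ ≤ ‖t‖ ∧ ‖t‖ ≤ b ∧ ∀ p ∈ X, dist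 p c ≤ 4 * b + 1 → (∃ q ∈ X, dist (p + t) q ≤ δ / 4) ∧ (∃ q ∈ X, dist (p - t) q ≤ δ / 4)) → (∀ c ∈ F, ∀ c' ∈ F, c ≠ c' → 8 * b + 2 < dist c c') → (F.card : ℝ) ≤ ε * L ^ 3 := by
  intro hFSC hESC hCEL hSEP x hx _h0
  obtain ⟨r₀, hr₀, hESC'⟩ := hESC
  obtain ⟨δ, b, κ, C, hδ, hδ7, hκ, hF⟩ := hFSC r₀ hr₀
  have hR'ge : 1 ≤ max (4 * b + 2 * r₀ + 4) (r₀ + 1) := le_trans (by linarith) (le_max_right _ _)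
  obtain ⟨c₀, hc₀, hE⟩ := hESC' (max (4 * b + 2 * r₀ + 4) (r₀ + 1)) hR'ge
  obtain ⟨X, hXsep, hXden, hXhull, hgood⟩ := PeriodCoherenceLadderSparseTransfer.noBadBalls_of_costs x
    (fun N i j hij => hSEP N (x N) (hx N) i j hij)
    (fun N => Literature.MathematicalPhysics.StatisticalMechanics.groundStateEnergy Literature.MathematicalPhysics.StatisticalMechanics.lennardJones 3 N - (N : ℝ) * (⨅ Q : Literature.MathematicalPhysics.StatisticalMechanics.PeriodicConfiguration 3, Q.energyPerParticle Literature.MathematicalPhysics.StatisticalMechanics.lennardJones))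
    (PeriodCoherenceLadderSparseTransfer.tendsto_excess_div _ _ hCEL)
    r₀ δ b κ C c₀ (max (4 * b + 2 * r₀ + 4) (r₀ + 1)) hr₀ hδ hδ7 hκ hc₀ (le_max_left _ _)
    (by linarith [le_max_right (4 * b + 2 * r₀ + 4) (r₀ + 1)])
    (fun N => hF N (x N) (hx N)) (fun N => hE N (x N) (hx N))
  refine ⟨δ, r₀ + 1, b, hδ, X, hXsep, hXden, hXhull, fun ε hε => ⟨0, fun L hL F _ hbad _ => ?_⟩⟩
  have hF0 : F = ∅ := Finset.eq_empty_of_forall_notMem fun c hc => hbad c hc (hgood c)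
  rw [hF0, Finset.card_empty, Nat.cast_zero]
  exact mul_nonneg hε.le (pow_nonneg hL 3)

/-- **The glue item, proved.** -/
theorem mesoscopicFromCosts_proof :
    Summit.AtomisticToContinuum.Crystallization.Theses.PeriodCoherenceLadder.MesoscopicFromCosts := by
  intro hFSC hESC
  exact PeriodCoherenceLadderCleanWindows.mesoscopicCoarsePeriods_of_badBallsSparse
    (sparse_of_costs_largeR hFSC hESC ChargedEnergyGapNegative.crysEnergyLimit
      (fun N y hy i j hij => LjLaminarWindowsSketch.lennardJones_groundState_dist_ge_seven_tenths hy hij))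

/-- The parent crux from its two children (same content, stated on the parent decl). -/
theorem mesoscopicCoarsePeriods_of_children
    (h₁ : Summit.AtomisticToContinuum.Crystallization.Theses.PeriodCoherenceLadder.FrustratedSitesCost)
    (h₂ : Summit.AtomisticToContinuum.Crystallization.Theses.PeriodCoherenceLadder.ExposedSitesCostLargeR) :
    Summit.AtomisticToContinuum.Crystallization.Theses.PeriodCoherenceLadder.MesoscopicCoarsePeriods :=
  mesoscopicFromCosts_proof h₁ h₂

end PeriodCoherenceLadderMesoscopicFromCosts

end Summit.AtomisticToContinuum.Crystallization.Theorems

end
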